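import Summits.QuantumAdvantage.QuantumAdvantage.Theses.LinnikCubicClassGroups

/-!
# Crux `LinnikCubicClassGroups.PureCubicClassGroupFBQP` (stmt-QuantumAdvantage-11544) —
# stub `stub_cubicFieldFacts`

Line `arakelov-giant-step-cycle`, stub `stub_cubicFieldFacts` (S4a): elementary arithmetic of pure
cubic fields `K ∋ α`, `α³ = m`, `m` a non-cube natural number. For a non-cube `m`:

* (0) `factsExists`: an admissible field exists — `ℚ[X]/(X³ − m)` (`X³ − m` is irreducible by the
  rational root theorem) is a number field of degree `3` with a cube root of `m`;
* (1) `factsNoQuadratic`: a cubic field has no quadratic subfield (tower law);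
* (2) `factsDiscr`: `|d_K| ≤ 27 m²` — `α` is integral and generates `K`, and
  `-27 m² = disc(1, α, α²) = r² · d_K` with `r ∈ ℤ` the determinant of the coordinates of
  `1, α, α²` in an integral basis (Mathlib `Algebra.discr_of_matrix_vecMul`,
  `Algebra.discr_powerBasis_eq_norm`);
* (3) `factsClassNumber`: `h_K ≤ (27 m²)^10` — Minkowski (`exists_ideal_in_class_of_norm_le`): every
  class contains an integral ideal of norm `≤ ⌊M_K⌋ ≤ 27 m²`; the ideals of norm `n ≥ 1` inject into
  the ideals of `𝓞_K/(n)` (a ring with `n³` elements) generated by `3` elements, so there are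
  `≤ n⁹` of them and `≤ B^10` ideals of norm in `[1, B]`;
* (4) `factsPrimesOver`: at most `3` prime ideals of `𝓞_K` have norm `p`
  (Mathlib `Ideal.card_primesOverFinset_le_finrank`).
-/

namespace Summit.QuantumAdvantage.QuantumAdvantage.Theorems.LinnikCubicClassGroups

open scoped NumberField nonZeroDivisors
open Polynomial

/-- If `m : ℕ` is not a cube then `X³ - m` is irreducible over `ℚ` (rational root theorem). -/
theorem facts_irreducible (m : ℕ) (hm : ∀ r : ℕ, r ^ 3 ≠ m) :
    Irreducible (X ^ 3 - C (m : ℚ) : ℚ[X]) := by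
  refine X_pow_sub_C_irreducible_of_prime Nat.prime_three fun b hb => ?_
  have hint : IsLocalization.IsInteger ℤ b := by
    refine isInteger_of_is_root_of_monic (p := X ^ 3 - C (m : ℤ))
      (monic_X_pow_sub_C _ three_ne_zero) ?_
    simp [hb]
  obtain ⟨y, hy⟩ := hint
  apply hm y.natAbs
  have h1 : (y : ℚ) ^ 3 = m := by rw [← hb, ← hy]; rfl
  have h2 : y ^ 3 = (m : ℤ) := by exact_mod_cast h1
  rw [← Int.natAbs_pow, h2, Int.natAbs_natCast]

/-- Part (0): for a non-cube `m`, the field `ℚ[X]/(X³ - m)` is a cubic number field containing a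
cube root of `m`. -/
theorem factsExists (m : ℕ) (hm : ∀ r : ℕ, r ^ 3 ≠ m) :
    ∃ (K : Type) (_ : Field K) (_ : NumberField K),
      Module.finrank ℚ K = 3 ∧ ∃ α : K, α ^ 3 = (m : K) := by
  haveI hirr : Fact (Irreducible (X ^ 3 - C (m : ℚ))) := ⟨facts_irreducible m hm⟩
  have hf : (X ^ 3 - C (m : ℚ)) ≠ 0 := hirr.out.ne_zero
  haveI : NumberField (AdjoinRoot (X ^ 3 - C (m : ℚ))) :=
    { to_charZero := charZero_of_injective_algebraMap (algebraMap ℚ _).injective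
      to_finiteDimensional := (AdjoinRoot.powerBasis hf).finite }
  refine ⟨AdjoinRoot (X ^ 3 - C (m : ℚ)), inferInstance, inferInstance, ?_, AdjoinRoot.root _, ?_⟩
  · rw [(AdjoinRoot.powerBasis hf).finrank, AdjoinRoot.powerBasis_dim, natDegree_X_pow_sub_C]
  · have := AdjoinRoot.eval₂_root (X ^ 3 - C (m : ℚ))
    simp only [eval₂_sub, eval₂_X_pow, eval₂_C, sub_eq_zero] at this
    exact this.trans (map_natCast _ _)

/-- Part (1): a cubic field has no quadratic subfield (tower law). -/
theorem factsNoQuadratic (K : Type*) [Field K] [NumberField K] (hdeg : Module.finrank ℚ K = 3)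
    (F : IntermediateField ℚ K) : Module.finrank ℚ F ≠ 2 := by
  intro h2
  have h := Module.finrank_mul_finrank ℚ F K
  rw [hdeg, h2] at h
  omega

/-- Part (4): at most three prime ideals of the ring of integers of a cubic field have norm `p`. -/
theorem factsPrimesOver (K : Type*) [Field K] [NumberField K] (hdeg : Module.finrank ℚ K = 3)
    (p : ℕ) (hp : p.Prime) :
    {P : Ideal (𝓞 K) | P.IsPrime ∧ Ideal.absNorm P = p}.ncard ≤ 3 := by
  classical
  have hp0 : (Ideal.span {(p : ℤ)}) ≠ ⊥ := by simp [hp.ne_zero]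
  haveI hmax : (Ideal.span {(p : ℤ)}).IsMaximal :=
    ((Ideal.span_singleton_prime (by exact_mod_cast hp.ne_zero)).mpr
      (Nat.prime_iff_prime_int.mp hp)).isMaximal hp0
  have hsub : {P : Ideal (𝓞 K) | P.IsPrime ∧ Ideal.absNorm P = p} ⊆
      ↑(IsDedekindDomain.primesOverFinset (Ideal.span {(p : ℤ)}) (𝓞 K)) := by
    rintro P ⟨hP, hPn⟩
    rw [Finset.mem_coe, IsDedekindDomain.mem_primesOverFinset_iff hp0]
    refine ⟨hP, ⟨hmax.eq_of_le (Ideal.IsPrime.under ℤ P).ne_top ?_⟩⟩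
    rw [Ideal.span_singleton_le_iff_mem, Ideal.mem_under, map_natCast, ← hPn]
    exact Ideal.absNorm_mem P
  refine (Set.ncard_le_ncard hsub (Finset.finite_toSet _)).trans ?_
  rw [Set.ncard_coe_finset, ← hdeg]
  exact Ideal.card_primesOverFinset_le_finrank (𝓞 K) ℚ K hp0

section discr

variable {K : Type*} [Field K] [NumberField K]

/-- In a cubic field a cube root `α` of a non-cube `m` generates a power basis `1, α, α²` over `ℚ`
whose discriminant is `disc(X³ - m) = -27 m²`. -/
theorem facts_discr_powers (hdeg : Module.finrank ℚ K = 3) {m : ℕ} (hm : ∀ r : ℕ, r ^ 3 ≠ m)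
    {α : K} (hα : α ^ 3 = (m : K)) :
    ∃ pb : PowerBasis ℚ K, pb.gen = α ∧ pb.dim = 3 ∧
      Algebra.discr ℚ ⇑pb.basis = -27 * (m : ℚ) ^ 2 := by
  have hint : IsIntegral ℚ α := Algebra.IsIntegral.isIntegral α
  have hmin : minpoly ℚ α = X ^ 3 - C (m : ℚ) :=
    (minpoly.eq_of_irreducible_of_monic (facts_irreducible m hm) (by simp [hα])
      (monic_X_pow_sub_C _ three_ne_zero)).symm
  have hnat : (minpoly ℚ α).natDegree = 3 := by rw [hmin, natDegree_X_pow_sub_C]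
  have htop : Algebra.adjoin ℚ {α} = ⊤ :=
    (IntermediateField.adjoin_eq_top_iff_of_isAlgebraic
      fun x _ => Algebra.IsAlgebraic.isAlgebraic x).mp
      ((Field.primitive_element_iff_minpoly_natDegree_eq ℚ α).mpr (hnat.trans hdeg.symm))
  have hnorm : Algebra.norm ℚ α = m := by
    have := Algebra.PowerBasis.norm_gen_eq_coeff_zero_minpoly (PowerBasis.ofAdjoinEqTop hint htop)
    rw [PowerBasis.ofAdjoinEqTop_gen, PowerBasis.ofAdjoinEqTop_dim, hnat, hmin] at this
    rw [this, coeff_sub, coeff_X_pow, coeff_C_zero]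
    norm_num
  refine ⟨PowerBasis.ofAdjoinEqTop hint htop, rfl, hnat, ?_⟩
  rw [Algebra.discr_powerBasis_eq_norm, PowerBasis.ofAdjoinEqTop_gen, hdeg, hmin]
  have h3 : (aeval α) (derivative (X ^ 3 - C (m : ℚ))) = algebraMap ℚ K 3 * α ^ 2 := by
    rw [derivative_sub, derivative_X_pow, derivative_C, sub_zero, map_mul, aeval_C, map_pow,
      aeval_X]
    norm_num
  rw [h3, map_mul, Algebra.norm_algebraMap, map_pow, hnorm, hdeg]
  norm_num

/-- If a family `v` of algebraic integers of `K`, indexed like the integral basis of `K`, has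
(rational) discriminant `D`, then `D = r² · d_K` for some integer `r` (the determinant of the
integer matrix of coordinates of `v` in the integral basis). -/
theorem facts_discr_eq_sq_mul (v : Module.Free.ChooseBasisIndex ℤ (𝓞 K) → K)
    (hv : ∀ i, IsIntegral ℤ (v i)) :
    ∃ r : ℤ, Algebra.discr ℚ v = r ^ 2 * NumberField.discr K := by
  classical
  have hint : ∀ i j, IsIntegral ℤ ((NumberField.integralBasis K).toMatrix v i j) := by
    intro i j
    have : v j = algebraMap (𝓞 K) K ⟨v j, (mem_integralClosure_iff ℤ K).mpr (hv j)⟩ := rfl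
    rw [Module.Basis.toMatrix_apply, this, NumberField.integralBasis_repr_apply]
    exact isIntegral_algebraMap
  obtain ⟨r, hr⟩ := IsIntegrallyClosed.isIntegral_iff.1 (IsIntegral.det hint)
  refine ⟨r, ?_⟩
  rw [← (NumberField.integralBasis K).toMatrix_map_vecMul v, Algebra.discr_of_matrix_vecMul,
    ← hr, ← NumberField.coe_discr]
  simp

/-- Part (2): `|d_K| ≤ 27 m²` for a cubic field `K ∋ α`, `α³ = m`, `m` a non-cube:
`-27 m² = disc(1, α, α²) = [𝓞_K : ℤ[α]]² · d_K`. -/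
theorem factsDiscr (hdeg : Module.finrank ℚ K = 3) {m : ℕ} (hm : ∀ r : ℕ, r ^ 3 ≠ m)
    {α : K} (hα : α ^ 3 = (m : K)) : |NumberField.discr K| ≤ 27 * (m : ℤ) ^ 2 := by
  classical
  obtain ⟨pb, hgen, hdim, hdiscr⟩ := facts_discr_powers hdeg hm hα
  have hcard : Fintype.card (Fin pb.dim) =
      Fintype.card (Module.Free.ChooseBasisIndex ℤ (𝓞 K)) := by
    rw [← Module.finrank_eq_card_chooseBasisIndex, NumberField.RingOfIntegers.rank, hdeg, hdim,
      Fintype.card_fin]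
  have hαint : IsIntegral ℤ α :=
    ⟨X ^ 3 - C (m : ℤ), monic_X_pow_sub_C _ three_ne_zero, by simp [hα]⟩
  obtain ⟨r, hr⟩ := facts_discr_eq_sq_mul (K := K) (⇑pb.basis ∘ ⇑(Fintype.equivOfCardEq hcard).symm)
    (fun i => by simp only [Function.comp_apply, PowerBasis.coe_basis, hgen]; exact hαint.pow _)
  rw [Algebra.discr_reindex, hdiscr] at hr
  have hz : (-27 * (m : ℤ) ^ 2 : ℤ) = r ^ 2 * NumberField.discr K := by exact_mod_cast hr
  have hm0 : (m : ℤ) ≠ 0 := by exact_mod_cast fun h => hm 0 (by rw [h]; rfl)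
  have hr0 : r ≠ 0 := by
    rintro rfl
    simp only [ne_eq, zero_pow, OfNat.ofNat_ne_zero, not_false_eq_true, zero_mul, mul_eq_zero,
      neg_eq_zero, OfNat.ofNat_ne_zero, false_or, pow_eq_zero_iff] at hz
    exact hm0 hz
  have h1 : 0 < r ^ 2 := by positivity
  rw [abs_le]
  constructor <;> nlinarith [sq_nonneg (m : ℤ)]

end discr

section classNumber

variable {K : Type*} [Field K] [NumberField K]

/-- In a cubic field, the ideals of `𝓞 K` of norm `n ≥ 1` number at most `n ^ 9`: such an ideal `I`
contains `n`, so it is the preimage of the ideal of `𝓞 K ⧸ (n)` (a ring with `n³` elements)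
spanned by the images of a `ℤ`-basis of `I`, which has `3` elements. -/
theorem facts_ideals_of_norm (hdeg : Module.finrank ℚ K = 3) {n : ℕ} (hn : n ≠ 0) :
    {I : Ideal (𝓞 K) | Ideal.absNorm I = n}.ncard ≤ n ^ 9 := by
  classical
  have hι : Fintype.card (Module.Free.ChooseBasisIndex ℤ (𝓞 K)) = 3 := by
    rw [← Module.finrank_eq_card_chooseBasisIndex, NumberField.RingOfIntegers.rank, hdeg]
  have hcard : Nat.card (𝓞 K ⧸ Ideal.span {(n : 𝓞 K)}) = n ^ 3 := by
    rw [← Submodule.cardQuot_apply, ← Ideal.absNorm_apply, Ideal.absNorm_span_singleton,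
      ← map_natCast (algebraMap ℤ (𝓞 K)), Algebra.norm_algebraMap,
      NumberField.RingOfIntegers.rank, hdeg, Int.natAbs_pow, Int.natAbs_natCast]
  haveI : Finite (𝓞 K ⧸ Ideal.span {(n : 𝓞 K)}) :=
    Nat.finite_of_card_ne_zero (by rw [hcard]; positivity)
  set q := Ideal.Quotient.mk (Ideal.span {(n : 𝓞 K)})
  let G : (Module.Free.ChooseBasisIndex ℤ (𝓞 K) → 𝓞 K ⧸ Ideal.span {(n : 𝓞 K)}) →
      Ideal (𝓞 K) := fun g => Ideal.comap q (Ideal.span (Set.range g))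
  have hsub : {I : Ideal (𝓞 K) | Ideal.absNorm I = n} ⊆ Set.range G := by
    intro I hI
    rw [Set.mem_setOf_eq] at hI
    have hI0 : I ≠ ⊥ := by
      rintro rfl
      rw [Ideal.absNorm_bot] at hI
      exact hn hI.symm
    have hle : Ideal.span {(n : 𝓞 K)} ≤ I := hI ▸ Ideal.span_singleton_absNorm_le I
    let b := Ideal.selfBasis (NumberField.RingOfIntegers.basis K) I hI0
    refine ⟨fun i => q (b i), ?_⟩
    show Ideal.comap q (Ideal.span (Set.range fun i => q (b i))) = I
    conv_rhs => rw [← Ideal.comap_map_mk hle]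
    congr 1
    apply le_antisymm
    · rw [Ideal.span_le]
      rintro _ ⟨i, rfl⟩
      exact Ideal.mem_map_of_mem q (b i).2
    · rw [Ideal.map_le_iff_le_comap]
      intro x hx
      have hx' := congr_arg (fun y : I => q (y : 𝓞 K)) (b.sum_repr ⟨x, hx⟩)
      simp only [Submodule.coe_sum, Submodule.coe_smul_of_tower, map_sum, map_zsmul] at hx'
      rw [Ideal.mem_comap, ← hx']
      exact Ideal.sum_mem _ fun i _ => zsmul_mem (Ideal.subset_span (Set.mem_range_self i)) _
  calc {I : Ideal (𝓞 K) | Ideal.absNorm I = n}.ncard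
      ≤ (Set.range G).ncard := Set.ncard_le_ncard hsub (Set.finite_range G)
    _ ≤ Nat.card (Module.Free.ChooseBasisIndex ℤ (𝓞 K) → 𝓞 K ⧸ Ideal.span {(n : 𝓞 K)}) := by
        rw [← Set.image_univ, ← Set.ncard_univ]
        exact Set.ncard_image_le Set.finite_univ
    _ = n ^ 9 := by
        rw [Nat.card_fun, hcard, Nat.card_eq_fintype_card, hι, ← pow_mul]

/-- Summing the previous count: the ideals of `𝓞 K` of norm in `[1, B]` number at most `B ^ 10`. -/
theorem facts_ideals_le (hdeg : Module.finrank ℚ K = 3) (B : ℕ) :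
    {I : Ideal (𝓞 K) | 1 ≤ Ideal.absNorm I ∧ Ideal.absNorm I ≤ B}.ncard ≤ B ^ 10 := by
  induction B with
  | zero =>
    rw [show {I : Ideal (𝓞 K) | 1 ≤ Ideal.absNorm I ∧ Ideal.absNorm I ≤ 0} = ∅ from
      Set.eq_empty_of_forall_notMem fun I hI => by simp only [Set.mem_setOf_eq] at hI; omega]
    simp
  | succ B ih =>
    have hsplit : {I : Ideal (𝓞 K) | 1 ≤ Ideal.absNorm I ∧ Ideal.absNorm I ≤ B + 1} ⊆
        {I | 1 ≤ Ideal.absNorm I ∧ Ideal.absNorm I ≤ B} ∪ {I | Ideal.absNorm I = B + 1} := by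
      rintro I ⟨h1, h2⟩
      rcases Nat.lt_or_ge (Ideal.absNorm I) (B + 1) with h | h
      · exact Or.inl ⟨h1, Nat.lt_succ_iff.mp h⟩
      · exact Or.inr (le_antisymm h2 h)
    have hfin : ({I : Ideal (𝓞 K) | 1 ≤ Ideal.absNorm I ∧ Ideal.absNorm I ≤ B} ∪
        {I | Ideal.absNorm I = B + 1}).Finite :=
      ((Ideal.finite_setOf_absNorm_le B).subset fun I hI => hI.2).union
        (Ideal.finite_setOf_absNorm_eq _)
    calc _ ≤ _ := Set.ncard_le_ncard hsplit hfin
      _ ≤ _ := Set.ncard_union_le _ _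
      _ ≤ B ^ 10 + (B + 1) ^ 9 := add_le_add ih (facts_ideals_of_norm hdeg B.succ_ne_zero)
      _ = B ^ 9 * B + (B + 1) ^ 9 := by ring
      _ ≤ (B + 1) ^ 9 * B + (B + 1) ^ 9 := by gcongr; exact B.le_succ
      _ = (B + 1) ^ 10 := by ring

open NumberField NumberField.InfinitePlace Module Real in
/-- The Minkowski bound of a cubic field `K ∋ α`, `α³ = m` (`m` a non-cube) is at most `27 m²`
(crude: it is `< 2m`). -/
theorem facts_minkowski_le (hdeg : Module.finrank ℚ K = 3) {m : ℕ} (hm : ∀ r : ℕ, r ^ 3 ≠ m)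
    {α : K} (hα : α ^ 3 = (m : K)) :
    (4 / π) ^ nrComplexPlaces K *
        ((Nat.factorial (finrank ℚ K) : ℝ) / (finrank ℚ K : ℝ) ^ finrank ℚ K *
          √|(discr K : ℝ)|) ≤ ((27 * m ^ 2 : ℕ) : ℝ) := by
  have hr2 : nrComplexPlaces K ≤ 1 := by
    have := card_add_two_mul_card_eq_rank K; omega
  have h1 : (4 / π : ℝ) ^ nrComplexPlaces K ≤ 2 := by
    rcases Nat.le_one_iff_eq_zero_or_eq_one.mp hr2 with h | h <;> rw [h]
    · norm_num
    · rw [pow_one, div_le_iff₀ Real.pi_pos]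
      linarith [Real.two_le_pi]
  have h2 : ((Nat.factorial (finrank ℚ K) : ℝ) / (finrank ℚ K : ℝ) ^ finrank ℚ K) ≤ 1 := by
    rw [hdeg]; norm_num [Nat.factorial]
  have hm1 : (1 : ℝ) ≤ m := by
    have : m ≠ 0 := fun h => hm 0 (by rw [h]; rfl)
    exact_mod_cast Nat.one_le_iff_ne_zero.mpr this
  have h3 : √|(discr K : ℝ)| ≤ 6 * m := by
    rw [Real.sqrt_le_left (by positivity)]
    have h := factsDiscr hdeg hm hα
    have h' : ((|discr K| : ℤ) : ℝ) ≤ 27 * (m : ℝ) ^ 2 := by exact_mod_cast h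
    rw [Int.cast_abs] at h'
    nlinarith
  calc (4 / π) ^ nrComplexPlaces K * ((Nat.factorial (finrank ℚ K) : ℝ) /
          (finrank ℚ K : ℝ) ^ finrank ℚ K * √|(discr K : ℝ)|)
      ≤ 2 * (1 * (6 * m)) := by gcongr
    _ ≤ ((27 * m ^ 2 : ℕ) : ℝ) := by push_cast; nlinarith

open NumberField in
/-- Part (3): `h_K ≤ (27 m²)^10` for a cubic field `K ∋ α`, `α³ = m`, `m` a non-cube: by Minkowski
every class contains an integral ideal of norm `≤ 27 m²`, and there are at most `B^10` ideals of
norm in `[1, B]`. -/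
theorem factsClassNumber (hdeg : Module.finrank ℚ K = 3) {m : ℕ} (hm : ∀ r : ℕ, r ^ 3 ≠ m)
    {α : K} (hα : α ^ 3 = (m : K)) : NumberField.classNumber K ≤ (27 * m ^ 2) ^ 10 := by
  classical
  set B := ⌊(4 / Real.pi) ^ InfinitePlace.nrComplexPlaces K *
    ((Nat.factorial (Module.finrank ℚ K) : ℝ) / (Module.finrank ℚ K : ℝ) ^ Module.finrank ℚ K *
      √|(discr K : ℝ)|)⌋₊ with hB_def
  have hB : B ≤ 27 * m ^ 2 := Nat.floor_le_of_le (facts_minkowski_le hdeg hm hα)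
  set T := {I : Ideal (𝓞 K) | 1 ≤ Ideal.absNorm I ∧ Ideal.absNorm I ≤ B}
  have hfin : T.Finite := (Ideal.finite_setOf_absNorm_le B).subset fun I hI => hI.2
  have hinj : classNumber K ≤ T.ncard := by
    haveI := hfin.to_subtype
    rw [classNumber, ← Nat.card_eq_fintype_card, ← Nat.card_coe_set_eq]
    refine Nat.card_le_card_of_injective
      (fun C => ⟨((exists_ideal_in_class_of_norm_le C).choose : (Ideal (𝓞 K))⁰),
        Nat.one_le_iff_ne_zero.mpr (Ideal.absNorm_ne_zero_of_nonZeroDivisors _),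
        Nat.le_floor (exists_ideal_in_class_of_norm_le C).choose_spec.2⟩) ?_
    intro C D h
    have h' : (exists_ideal_in_class_of_norm_le C).choose =
        (exists_ideal_in_class_of_norm_le D).choose :=
      Subtype.val_injective (by simpa only [Subtype.mk.injEq] using h)
    rw [← (exists_ideal_in_class_of_norm_le C).choose_spec.1, h',
      (exists_ideal_in_class_of_norm_le D).choose_spec.1]
  calc classNumber K ≤ T.ncard := hinj
    _ ≤ B ^ 10 := facts_ideals_le hdeg B
    _ ≤ (27 * m ^ 2) ^ 10 := Nat.pow_le_pow_left hB 10

end classNumber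

/-- **S4a `stub_cubicFieldFacts`**: elementary arithmetic of pure cubic fields. For a non-cube `m`:
(0) an admissible field exists (`ℚ[X]/(X³ − m)`, irreducible by the rational root theorem, a cubic
number field with a cube root of `m`); and for every cubic number field `K ∋ α`, `α³ = m`:
(1) `K` has no quadratic subfield (tower law); (2) `|d_K| ≤ 27 m²`
(`-27 m² = disc(1, α, α²) = [𝓞_K : ℤ[α]]² · d_K`); (3) `h_K ≤ (27 m²)^10` (Minkowski: every class
contains an integral ideal of norm `≤ 27 m²`, and there are at most `n⁹` ideals of norm `n ≥ 1`);
(4) at most `3` prime ideals of `𝓞_K` have norm `p` (`Σ e f = 3`). -/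
theorem stub_cubicFieldFacts : ∀ m : ℕ, (∀ r : ℕ, r ^ 3 ≠ m) →
      (∃ (K : Type) (_ : Field K) (_ : NumberField K), Module.finrank ℚ K = 3 ∧ ∃ α : K, α ^ 3 = (m : K)) ∧
      ∀ (K : Type) [Field K] [NumberField K], Module.finrank ℚ K = 3 → (∃ α : K, α ^ 3 = (m : K)) →
        (∀ F : IntermediateField ℚ K, Module.finrank ℚ F ≠ 2) ∧
        |NumberField.discr K| ≤ 27 * (m : ℤ) ^ 2 ∧
        NumberField.classNumber K ≤ (27 * m ^ 2) ^ 10 ∧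
        ∀ p : ℕ, p.Prime → {P : Ideal (𝓞 K) | P.IsPrime ∧ Ideal.absNorm P = p}.ncard ≤ 3 :=
  fun m hm => ⟨factsExists m hm, fun K _ _ hdeg ⟨_, hα⟩ =>
    ⟨factsNoQuadratic K hdeg, factsDiscr hdeg hm hα, factsClassNumber hdeg hm hα,
      factsPrimesOver K hdeg⟩⟩

end Summit.QuantumAdvantage.QuantumAdvantage.Theorems.LinnikCubicClassGroups
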